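import Summits.HubbardSuperconductivity.HubbardSuperconductivity.Theorems.KLProgrammeKLRegimeFlowReadScaleZeroSunsetCertRowsFarSup

/-!
# Route `KLProgramme`, crux K3 — engine-flow child (stmt-HubbardSuperconductivity-20437), stub (C) at `n = 0`, located item #22a «(C)-SCALE0-PT2»:
# THE CERTIFIED SUNSET ROWS, THREE-SHELLS FORM — high shell by name, TWO low shells `(0, ω₀)` / `[ω₀, ω₁)` with separate far envelopes

Seat hubbard-kl-k3c5-p1 (g18; owner of #22a).  Pen (R361)(1) books the far-gap record B′ «in the TWO-LOW-SHELL format (gaps on `(0, 1/32)` and `[1/32, ¼)`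
separately)»; the readers of record (`…SunsetCertRowsTwoShells(Sup)`, p1 g22's `…SunsetCertRowsFarSup` §1–§3, `…SunsetCertRowsRecordsFarSup`) carry ONE low
envelope `Dlow k` on all `|ω_i| < ω₁` with budget weight `ω₁`.  This file is the line-by-line twin of `…SunsetCertRowsFarSup` §1–§2 with the low shell split
at `ω₀` (`0 < ω₀`; design value `klE0 = 1/32`): envelope `Dlo k` on `|ω_i| < ω₀` (weight `ω₀`), `Dmid k` on `ω₀ ≤ |ω_i| < ω₁` (weight `ω₁`, by the same
frequency-count-free window sum `…TwoShells.sum_l2Far_low_le`), high shell `|ω_i| ≥ ω₁ ≥ klE0` by name (`sum_l2Far_high_le`):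
* §0 `l2Far_envelope_of_farLattice_klEng_on` — p1 g22's `l2Far_low_envelope_of_farLattice_klEng` with the guard `|ω_i| < ω₁` replaced by any predicate;
* §1 **`sunsetRows_of_certV3_threeShells_farSup`** — `hS0`/`hSk` from the near certificate, `hlo`, `hmid`, the external far sup `Sf`, and
  `bS k ≥ row k + Sf·(2ᵏ·2500·C(ω₁,Rc)/ω₁ + (ω₀·Dlo k + ω₁·Dmid k))`;
* §2 **`sunsetRows_of_certV3_plancherelGaps3_farSup`** — the Parseval-gaps layer: two gap pairs `(G₀lo, G₂lo)` on `|ω_i| < ω₀` and `(G₀mid, G₂mid)` on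
  `ω₀ ≤ |ω_i| < ω₁` (`D_1 := √(D_0 D_2)` each), envelopes `(√D + 10⁻¹⁰)²` at `L ≥ klEngL₃ β U`.
SIZES [float / est., labelled; (R414)(B) with `Sfar = 3.535·10⁻⁵`, Rc = 1024, ω₀ = 1/32, ω₁ = 1/4]: far row₂ ≈ Sfar·(G₂lo/32 + G₂mid/4) ≈ 0.022 at the float-level
`G₂lo ≤ 2·10⁴` and `G₂mid ≈ 0` (vs 0.177 one-shell) — the split buys ≈ 0.15 of `bS₂ = 1.0`; `G₂mid` is moreover reachable kit-free (order-4 sup-Sobolev tail of the pure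
resolvent symbol, `W ≡ 1` for `|ω| ≥ klE0`; est. ≲ 10³) — not done here.  The companion `…SunsetCertRowsThreeShellsRecords` carries §3 (far-sup certificate) and the
records one-call.  No definitions; nothing here asserts (C), any stub of 20437, K3 or superconductivity; the certificates are named hypotheses.
References: BGM 2006 §2.3 (2.17)–(2.20), §3 (3.2) [cite: BenfattoGiulianiMastropietro2006].
-/

noncomputable section

namespace Summit.HubbardSuperconductivity.HubbardSuperconductivity.Theorems.KLRegimeSplit

set_option linter.dupNamespace false -- summit = problem name (single-conjunct summit), D-0017

open Literature.MathematicalPhysics.QuantumLattice Literature.Probability.LatticeModels Literature.Analysis.FunctionSpaces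
open Summit.HubbardSuperconductivity.HubbardSuperconductivity.Theorems.DispersionFlow
open Summit.HubbardSuperconductivity.HubbardSuperconductivity.Theorems.EngineV8
open MeasureTheory Set Finset Complex UnitAddTorus Real GrassmannAlgebra Matrix
open scoped FourierTransform Nat ENNReal NNReal

variable {L M : ℕ} [NeZero L]

/-! ## §0 The far-ℓ² envelope at the engine thresholds, on an arbitrary set of window frequencies -/

/-- **Guarded envelope** (the proof of `l2Far_low_envelope_of_farLattice_klEng` verbatim, the guard `|ω_i| < ω₁` replaced by an arbitrary predicate `P`):
at `β ≥ klBetaMin`, `0 < U ≤ 2⁻²⁰`, `L ≥ klEngL₃ β U`, far lattice sums `≤ D k` at the frequencies in `P` give far weighted ℓ² `≤ (√(D k) + 10⁻¹⁰)²` there.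
[cite: BenfattoGiulianiMastropietro2006, §2.3 (2.17)-(2.20)] -/
theorem l2Far_envelope_of_farLattice_klEng_on {M : ℕ} (μ : ℝ) {β U : ℝ} (hβ : klBetaMin ≤ β) (hU0 : 0 < U) (hU : U ≤ (2 : ℝ)⁻¹ ^ 20)
    (hL : klEngL₃ β U ≤ L) (P : MatsubaraIdx M → Prop) (c : SunsetCellRecordV2) {D : Fin 3 → ℝ}
    (hD : ∀ (k : Fin 3) (i : MatsubaraIdx M), P i →
      ∑' z : Site 2, (if z ≠ 0 ∧ z ∉ c.disk then Real.sqrt ((((z 0 : ℤ) : ℝ)) ^ 2 + (((z 1 : ℤ) : ℝ)) ^ 2) ^ (k : ℕ) else 0) *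
        ‖mFourierCoeff (Torus.descend (fun y : Momentum => uvSymbolFn 1 klE0 (frameLevel μ 0 ((2 * π) • y)) (matsubaraFreq β M i))
          (uvSpatialSymbol_isLatticePeriodic 1 klE0 μ 0 (matsubaraFreq β M i))) (-z)‖ ^ 2 ≤ D k) :
    ∀ (k : Fin 3) (i : MatsubaraIdx M), P i →
      ∑ u : TorusSite 2 L,
        (if u ≠ 0 ∧ (fun j => (u j).valMinAbs : Site 2) ∉ c.disk then
          Real.sqrt ((((u 0).valMinAbs.natAbs : ℝ)) ^ 2 + (((u 1).valMinAbs.natAbs : ℝ)) ^ 2) ^ (k : ℕ) *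
            ‖torusFourierInv (fun kv : TorusSite 2 L =>
              (fun y : Momentum => uvSymbolFn 1 klE0 (frameLevel μ 0 ((2 * π) • y)) (matsubaraFreq β M i))
                (WithLp.toLp 2 fun j => ((kv j).val : ℝ) / L)) u‖ ^ 2
          else 0) ≤
      (Real.sqrt (D k) + (10 : ℝ)⁻¹ ^ 10) ^ 2 := by
  have hβ₀ : (0 : ℝ) < klBetaMin := by norm_num [klBetaMin]
  have hβpos : 0 < β := lt_of_lt_of_le hβ₀ hβ
  intro k i hi
  have h := l2Far_low_of_farLattice_uniform (L := L) μ c (matsubaraFreq_ne_zero' hβpos i) k (hD k i hi) (le_refl (2 * 2))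
  have h4 : (2 * 2 : ℕ) = 4 := rfl
  simp only [h4] at h
  have himg := imagesTerm_le_of_klEngL₃ (L := L) k hβ hU0 hU hL
  have hT := one_le_klChi2CauchyTab 4
  have hS0 : 0 ≤ ∑' n : Site 2, ((1 + ‖n‖) ^ 4)⁻¹ := tsum_nonneg fun n => by positivity
  have hE0 : (0 : ℝ) < klE0 := by norm_num [klE0]
  have h0 : 0 ≤ Real.sqrt (D k) + Real.sqrt ((L : ℝ) ^ ((k : ℕ) + 2)) *
      (((4 : ℕ) ! * (klChi2CauchyTab 4 * ((4 : ℕ) + 1)! * (4 / klE0) ^ 2 * (4 / klE0) ^ (4 - 1)) * ((2 * π) * 4) ^ 4) / Real.pi ^ 4 *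
        (4 / (L : ℝ)) ^ 4 * ∑' n : Site 2, ((1 + ‖n‖) ^ 4)⁻¹) := by positivity
  exact h.trans (pow_le_pow_left₀ h0 (add_le_add le_rfl himg) 2)

/-! ## §1 Three-shells form, the far middle propagator by an external sup -/

/-- **THE CERTIFIED SUNSET ROWS — THREE-SHELLS FORM, EXTERNAL FAR SUP** (twin of `sunsetRows_of_certV3_twoShells_farSup`, low shell split at `ω₀`). [cite: BenfattoGiulianiMastropietro2006, §2.3 (2.17)-(2.20)] -/
theorem sunsetRows_of_certV3_threeShells_farSup [NeZero M] (c : SunsetCellRecordV3) (hc : ScaleZeroSunsetCertV3 c)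
    {μ β : ℝ} (hμlo : (c.μlo : ℝ) ≤ μ) (hμhi : μ ≤ c.μhi)
    (hβ : klBetaMin ≤ β) (hδ : β / ((2 * (2 * M) : ℕ) : ℝ) ≤ (2 : ℝ)⁻¹ ^ 10)
    {N' R : ℕ} (hN' : 2 * 2 ≤ N') (hR : R + 1 + 2 * c.Rc ≤ L)
    (hT : ENNReal.ofReal (β / klBetaMin) *
        ENNReal.ofReal ((19 / 3) * (4 + |μ| + (0 : TrigPolyC4v).coeffNorm 0) * β / (2 * π ^ 2 * M) +
            (N' ! * klChi2CauchyTab N' * (N' + 1) ! * 4 * (max 1 (4 / klE0)) ^ (N' - 1) * ((2 * π) * 4) ^ N') * (2 / klE0) *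
              (1 / (2 * Real.pi) ^ N' * (2 / ((2 * R + 2 : ℕ) : ℝ)) ^ (N' - 2 * 2) * (2 ^ 2 * ∑' k : Site 2, ∏ j, (1 + (k j : ℝ) ^ 2)⁻¹))) ≤
      ENNReal.ofReal (c.Tmax : ℝ))
    (hrow : ∀ k : Fin 3, 0 ≤ (c.row k : ℝ))
    {ω₀ ω₁ : ℝ} (hω₀ : 0 < ω₀) (hω₁ : klE0 ≤ ω₁) (hρ : Real.exp (-(Real.arsinh (ω₁ / 4) * L / 2)) ≤ 1 / 2)
    {Dlo Dmid : Fin 3 → ℝ} (hDlo : ∀ k : Fin 3, 0 ≤ Dlo k) (hDmid : ∀ k : Fin 3, 0 ≤ Dmid k)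
    (hlo : ∀ (k : Fin 3) (i : MatsubaraIdx M), |matsubaraFreq β M i| < ω₀ →
      ∑ u : TorusSite 2 L,
        (if u ≠ 0 ∧ (fun j => (u j).valMinAbs : Site 2) ∉ c.disk then
          Real.sqrt ((((u 0).valMinAbs.natAbs : ℝ)) ^ 2 + (((u 1).valMinAbs.natAbs : ℝ)) ^ 2) ^ (k : ℕ) *
            ‖torusFourierInv (fun kv : TorusSite 2 L =>
              (fun y : Momentum => uvSymbolFn 1 klE0 (frameLevel μ 0 ((2 * π) • y)) (matsubaraFreq β M i))
                (WithLp.toLp 2 fun j => ((kv j).val : ℝ) / L)) u‖ ^ 2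
          else 0) ≤ Dlo k)
    (hmid : ∀ (k : Fin 3) (i : MatsubaraIdx M), ω₀ ≤ |matsubaraFreq β M i| → |matsubaraFreq β M i| < ω₁ →
      ∑ u : TorusSite 2 L,
        (if u ≠ 0 ∧ (fun j => (u j).valMinAbs : Site 2) ∉ c.disk then
          Real.sqrt ((((u 0).valMinAbs.natAbs : ℝ)) ^ 2 + (((u 1).valMinAbs.natAbs : ℝ)) ^ 2) ^ (k : ℕ) *
            ‖torusFourierInv (fun kv : TorusSite 2 L =>
              (fun y : Momentum => uvSymbolFn 1 klE0 (frameLevel μ 0 ((2 * π) • y)) (matsubaraFreq β M i))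
                (WithLp.toLp 2 fun j => ((kv j).val : ℝ) / L)) u‖ ^ 2
          else 0) ≤ Dmid k)
    {Sf : ℝ} (hSf0 : 0 ≤ Sf)
    (hA2 : ∀ (σ : Fin 2) (p₀ : GridPoint L (2 * (2 * M))) (x : TorusSite 2 L),
      (x ≠ p₀.2 ∧ (fun j => ((x - p₀.2) j).valMinAbs : Site 2) ∉ c.disk) → ∀ j₁ : Fin (2 * (2 * M)),
        ‖((hubbardGridSub L M β (2 * (2 * M))).transpose * hubbardCovAboveCT L M β μ 0 0 klE0 * hubbardGridSub L M β (2 * (2 * M)))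
            (((p₀, σ), 0) : GridLeg (GridPoint L (2 * (2 * M)))) ((((j₁, x) : GridPoint L (2 * (2 * M))), σ), 1)‖ ≤ Sf)
    {bS : ℕ → ℝ}
    (hbS : ∀ k : Fin 3, (c.row k : ℝ) + Sf * (2 ^ (k : ℕ) * 2500 *
        ((max 1 ((2 * (k : ℕ) : ℝ) / Real.arsinh (ω₁ / 4))) ^ (k : ℕ) * Real.exp (-(Real.arsinh (ω₁ / 4) * (c.Rc + 1))) *
          (1 + 2 * (1 - Real.exp (-(Real.arsinh (ω₁ / 4) / 4)))⁻¹) ^ 2) / ω₁ + (ω₀ * Dlo k + ω₁ * Dmid k)) ≤ bS k) :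
    (∀ (σ : Fin 2) (p₀ : GridPoint L (2 * (2 * M))), ∑ p₁ : GridPoint L (2 * (2 * M)),
      (if p₁ = p₀ then (0 : ℝ) else (if p₁.2 - p₀.2 = 0 then (0 : ℝ) else 1) * ‖contr ℂ ((hubbardGridSub L M β (2 * (2 * M))).transpose * hubbardCovAboveCT L M β μ 0 0 klE0 *
                hubbardGridSub L M β (2 * (2 * M))) (((p₁, σ), 0) : GridLeg (GridPoint L (2 * (2 * M)))) ((p₀, σ), 1) *
              (contr ℂ ((hubbardGridSub L M β (2 * (2 * M))).transpose * hubbardCovAboveCT L M β μ 0 0 klE0 *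
                hubbardGridSub L M β (2 * (2 * M))) (((p₀, σ.rev), 0) : GridLeg (GridPoint L (2 * (2 * M)))) ((p₁, σ.rev), 1) *
                contr ℂ ((hubbardGridSub L M β (2 * (2 * M))).transpose * hubbardCovAboveCT L M β μ 0 0 klE0 *
                hubbardGridSub L M β (2 * (2 * M))) (((p₁, σ.rev), 0) : GridLeg (GridPoint L (2 * (2 * M)))) ((p₀, σ.rev), 1))‖) ≤ bS 0 * (((2 * (2 * M) : ℕ) : ℝ) / β)) ∧
    (∀ k, 1 ≤ k → k ≤ 2 → ∀ (σ : Fin 2) (p₀ : GridPoint L (2 * (2 * M))), ∑ p₁ : GridPoint L (2 * (2 * M)),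
      (if p₁ = p₀ then (0 : ℝ) else
        Real.sqrt ((((p₁.2 - p₀.2) 0).valMinAbs.natAbs : ℝ) ^ 2 + (((p₁.2 - p₀.2) 1).valMinAbs.natAbs : ℝ) ^ 2) ^ k * ‖contr ℂ ((hubbardGridSub L M β (2 * (2 * M))).transpose * hubbardCovAboveCT L M β μ 0 0 klE0 *
                hubbardGridSub L M β (2 * (2 * M))) (((p₁, σ), 0) : GridLeg (GridPoint L (2 * (2 * M)))) ((p₀, σ), 1) *
              (contr ℂ ((hubbardGridSub L M β (2 * (2 * M))).transpose * hubbardCovAboveCT L M β μ 0 0 klE0 *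
                hubbardGridSub L M β (2 * (2 * M))) (((p₀, σ.rev), 0) : GridLeg (GridPoint L (2 * (2 * M)))) ((p₁, σ.rev), 1) *
                contr ℂ ((hubbardGridSub L M β (2 * (2 * M))).transpose * hubbardCovAboveCT L M β μ 0 0 klE0 *
                hubbardGridSub L M β (2 * (2 * M))) (((p₁, σ.rev), 0) : GridLeg (GridPoint L (2 * (2 * M)))) ((p₀, σ.rev), 1))‖) ≤
        bS k * (((2 * (2 * M) : ℕ) : ℝ) / β)) := by
  classical
  have hβ₀ : (0 : ℝ) < klBetaMin := by norm_num [klBetaMin]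
  have hβpos : 0 < β := lt_of_lt_of_le hβ₀ hβ
  have hE0 : (0 : ℝ) < klE0 := by norm_num [klE0]
  have hω₁0 : 0 < ω₁ := lt_of_lt_of_le hE0 hω₁
  -- high-shell constant per row
  set Ch : Fin 3 → ℝ := fun k => 2 ^ (k : ℕ) * 2500 *
    ((max 1 ((2 * (k : ℕ) : ℝ) / Real.arsinh (ω₁ / 4))) ^ (k : ℕ) * Real.exp (-(Real.arsinh (ω₁ / 4) * (c.Rc + 1))) *
      (1 + 2 * (1 - Real.exp (-(Real.arsinh (ω₁ / 4) / 4)))⁻¹) ^ 2) / ω₁ with hCh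
  -- the per-frequency family: high shell by the strip, the two low shells by their envelopes
  set farL2 : Fin 3 → MatsubaraIdx M → ℝ := fun k i => ∑ u : TorusSite 2 L,
      (if u ≠ 0 ∧ (fun j => (u j).valMinAbs : Site 2) ∉ c.disk then
        Real.sqrt ((((u 0).valMinAbs.natAbs : ℝ)) ^ 2 + (((u 1).valMinAbs.natAbs : ℝ)) ^ 2) ^ (k : ℕ) *
          ‖torusFourierInv (fun kv : TorusSite 2 L =>
            (fun y : Momentum => uvSymbolFn 1 klE0 (frameLevel μ 0 ((2 * π) • y)) (matsubaraFreq β M i))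
              (WithLp.toLp 2 fun j => ((kv j).val : ℝ) / L)) u‖ ^ 2
        else 0) with hfarL2
  have hsplit : ∀ (k : Fin 3) (i : MatsubaraIdx M), farL2 k i ≤
      (if ω₁ ≤ |matsubaraFreq β M i| then farL2 k i else 0) +
        ((if |matsubaraFreq β M i| < ω₀ then Dlo k else 0) + (if |matsubaraFreq β M i| < ω₁ then Dmid k else 0)) := by
    intro k i
    by_cases h : ω₁ ≤ |matsubaraFreq β M i|
    · rw [if_pos h, if_neg (not_lt.2 h), add_zero]
      refine le_add_of_nonneg_right ?_
      split_ifs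
      · exact hDlo k
      · exact le_rfl
    · rw [if_neg h, if_pos (not_le.1 h), zero_add]
      by_cases h0 : |matsubaraFreq β M i| < ω₀
      · rw [if_pos h0]
        exact (hlo k i h0).trans (le_add_of_nonneg_right (hDmid k))
      · rw [if_neg h0, zero_add]
        exact hmid k i (not_lt.1 h0) (not_le.1 h)
  -- the window sum of the family
  have hΦsum : ∀ k : Fin 3, (1 / β) * ∑ i : MatsubaraIdx M, farL2 k i ≤ Ch k + (ω₀ * Dlo k + ω₁ * Dmid k) := by
    intro k
    have hhigh := sum_l2Far_high_le (L := L) c.toSunsetCellRecordV2 μ hβpos hω₁ hρ M k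
    have hlo' := sum_l2Far_low_le hβpos hω₀ (hDlo k) M
    have hmid' := sum_l2Far_low_le hβpos hω₁0 (hDmid k) M
    have h1 : ∑ i : MatsubaraIdx M, farL2 k i ≤ β * Ch k + (β * ω₀ * Dlo k + β * ω₁ * Dmid k) := by
      refine (Finset.sum_le_sum fun i _ => hsplit k i).trans ?_
      rw [Finset.sum_add_distrib, Finset.sum_add_distrib]
      refine add_le_add (le_trans (le_of_eq rfl) (hhigh.trans (le_of_eq ?_))) (add_le_add hlo' hmid')
      simp only [hCh]
    rw [one_div, inv_mul_le_iff₀ hβpos]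
    have : β * (Ch k + (ω₀ * Dlo k + ω₁ * Dmid k)) = β * Ch k + (β * ω₀ * Dlo k + β * ω₁ * Dmid k) := by ring
    linarith
  -- the far rows through the external sup
  have hfar : ∀ (k : Fin 3) (σ : Fin 2) (p₀ : GridPoint L (2 * (2 * M))), _ :=
    fun k σ p₀ => farRows_le_of_farSup (L := L) (M := M) c.toSunsetCellRecordV2 hβpos k (Φ := farL2 k) (fun i => le_rfl) σ p₀ hSf0 (hA2 σ.rev p₀)
  refine sunsetRows_of_certV3 c hc hμlo hμhi hβ hδ hN' hR hT hrow
    (bFar := fun k => Sf * (if hk : k < 3 then Ch ⟨k, hk⟩ + (ω₀ * Dlo ⟨k, hk⟩ + ω₁ * Dmid ⟨k, hk⟩) else 0))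
    (fun k σ p₀ => ?_) (fun k => ?_)
  · -- far row k ≤ Sf·(Ch + ω₀ Dlo + ω₁ Dmid)·(4M/β)
    have h := hfar k σ p₀
    refine h.trans ?_
    have hk : (k : ℕ) < 3 := k.isLt
    have hN : 0 ≤ (((2 * (2 * M) : ℕ) : ℝ) / β) := by positivity
    have hkey : Sf * ((1 / β) * ∑ i : MatsubaraIdx M, farL2 k i) ≤
        Sf * (if hk' : (k : ℕ) < 3 then Ch ⟨k, hk'⟩ + (ω₀ * Dlo ⟨k, hk'⟩ + ω₁ * Dmid ⟨k, hk'⟩) else 0) := by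
      rw [dif_pos hk]
      exact mul_le_mul_of_nonneg_left (hΦsum k) hSf0
    exact mul_le_mul_of_nonneg_right hkey hN
  · have hk : (k : ℕ) < 3 := k.isLt
    simp only [hk, dif_pos]
    exact hbS k

/-! ## §2 The Parseval-gaps layer, two low shells -/

/-- **THE CERTIFIED SUNSET ROWS FROM THE NEAR CERTIFICATE, TWO PAIRS OF FAR PARSEVAL GAPS AND AN EXTERNAL FAR SUP** (twin of `sunsetRows_of_certV3_plancherelGaps_farSup`). [cite: BenfattoGiulianiMastropietro2006, §2.3 (2.17)-(2.20)] -/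
theorem sunsetRows_of_certV3_plancherelGaps3_farSup [NeZero M] (c : SunsetCellRecordV3) (hc : ScaleZeroSunsetCertV3 c)
    {μ β U : ℝ} (hμlo : (c.μlo : ℝ) ≤ μ) (hμhi : μ ≤ c.μhi)
    (hβ : klBetaMin ≤ β) (hU0 : 0 < U) (hU : U ≤ (2 : ℝ)⁻¹ ^ 20) (hL3 : klEngL₃ β U ≤ L)
    (hδ : β / ((2 * (2 * M) : ℕ) : ℝ) ≤ (2 : ℝ)⁻¹ ^ 10)
    {N' R : ℕ} (hN' : 2 * 2 ≤ N') (hR : R + 1 + 2 * c.Rc ≤ L)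
    (hT : ENNReal.ofReal (β / klBetaMin) *
        ENNReal.ofReal ((19 / 3) * (4 + |μ| + (0 : TrigPolyC4v).coeffNorm 0) * β / (2 * π ^ 2 * M) +
            (N' ! * klChi2CauchyTab N' * (N' + 1) ! * 4 * (max 1 (4 / klE0)) ^ (N' - 1) * ((2 * π) * 4) ^ N') * (2 / klE0) *
              (1 / (2 * Real.pi) ^ N' * (2 / ((2 * R + 2 : ℕ) : ℝ)) ^ (N' - 2 * 2) * (2 ^ 2 * ∑' k : Site 2, ∏ j, (1 + (k j : ℝ) ^ 2)⁻¹))) ≤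
      ENNReal.ofReal (c.Tmax : ℝ))
    (hrow : ∀ k : Fin 3, 0 ≤ (c.row k : ℝ))
    {ω₀ ω₁ : ℝ} (hω₀ : 0 < ω₀) (hω₁ : klE0 ≤ ω₁)
    {G₀lo G₂lo G₀mid G₂mid : ℝ}
    (hgap0lo : ∀ i : MatsubaraIdx M, |matsubaraFreq β M i| < ω₀ →
      (∫ y in Torus.unitCube (Fin 2), ‖(fun y : Momentum => uvSymbolFn 1 klE0 (frameLevel μ 0 ((2 * π) • y)) (matsubaraFreq β M i)) y‖ ^ 2) -
        ∑ z ∈ insert (0 : Site 2) c.disk, ‖mFourierCoeff (Torus.descend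
          (fun y : Momentum => uvSymbolFn 1 klE0 (frameLevel μ 0 ((2 * π) • y)) (matsubaraFreq β M i))
          (uvSpatialSymbol_isLatticePeriodic 1 klE0 μ 0 (matsubaraFreq β M i))) (-z)‖ ^ 2 ≤ G₀lo)
    (hgap2lo : ∀ i : MatsubaraIdx M, |matsubaraFreq β M i| < ω₀ →
      (2 * π) ^ (-(2 : ℤ)) *
        ((∫ y in Torus.unitCube (Fin 2), ‖fderiv ℝ (fun y : Momentum => uvSymbolFn 1 klE0 (frameLevel μ 0 ((2 * π) • y)) (matsubaraFreq β M i)) y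
            (EuclideanSpace.single 0 (1 : ℝ))‖ ^ 2) +
          ∫ y in Torus.unitCube (Fin 2), ‖fderiv ℝ (fun y : Momentum => uvSymbolFn 1 klE0 (frameLevel μ 0 ((2 * π) • y)) (matsubaraFreq β M i)) y
            (EuclideanSpace.single 1 (1 : ℝ))‖ ^ 2) -
        ∑ z ∈ insert (0 : Site 2) c.disk, ((((z 0 : ℤ) : ℝ)) ^ 2 + (((z 1 : ℤ) : ℝ)) ^ 2) *
          ‖mFourierCoeff (Torus.descend (fun y : Momentum => uvSymbolFn 1 klE0 (frameLevel μ 0 ((2 * π) • y)) (matsubaraFreq β M i))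
            (uvSpatialSymbol_isLatticePeriodic 1 klE0 μ 0 (matsubaraFreq β M i))) (-z)‖ ^ 2 ≤ G₂lo)
    (hgap0mid : ∀ i : MatsubaraIdx M, ω₀ ≤ |matsubaraFreq β M i| → |matsubaraFreq β M i| < ω₁ →
      (∫ y in Torus.unitCube (Fin 2), ‖(fun y : Momentum => uvSymbolFn 1 klE0 (frameLevel μ 0 ((2 * π) • y)) (matsubaraFreq β M i)) y‖ ^ 2) -
        ∑ z ∈ insert (0 : Site 2) c.disk, ‖mFourierCoeff (Torus.descend
          (fun y : Momentum => uvSymbolFn 1 klE0 (frameLevel μ 0 ((2 * π) • y)) (matsubaraFreq β M i))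
          (uvSpatialSymbol_isLatticePeriodic 1 klE0 μ 0 (matsubaraFreq β M i))) (-z)‖ ^ 2 ≤ G₀mid)
    (hgap2mid : ∀ i : MatsubaraIdx M, ω₀ ≤ |matsubaraFreq β M i| → |matsubaraFreq β M i| < ω₁ →
      (2 * π) ^ (-(2 : ℤ)) *
        ((∫ y in Torus.unitCube (Fin 2), ‖fderiv ℝ (fun y : Momentum => uvSymbolFn 1 klE0 (frameLevel μ 0 ((2 * π) • y)) (matsubaraFreq β M i)) y
            (EuclideanSpace.single 0 (1 : ℝ))‖ ^ 2) +
          ∫ y in Torus.unitCube (Fin 2), ‖fderiv ℝ (fun y : Momentum => uvSymbolFn 1 klE0 (frameLevel μ 0 ((2 * π) • y)) (matsubaraFreq β M i)) y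
            (EuclideanSpace.single 1 (1 : ℝ))‖ ^ 2) -
        ∑ z ∈ insert (0 : Site 2) c.disk, ((((z 0 : ℤ) : ℝ)) ^ 2 + (((z 1 : ℤ) : ℝ)) ^ 2) *
          ‖mFourierCoeff (Torus.descend (fun y : Momentum => uvSymbolFn 1 klE0 (frameLevel μ 0 ((2 * π) • y)) (matsubaraFreq β M i))
            (uvSpatialSymbol_isLatticePeriodic 1 klE0 μ 0 (matsubaraFreq β M i))) (-z)‖ ^ 2 ≤ G₂mid)
    {Sf : ℝ} (hSf0 : 0 ≤ Sf)
    (hA2 : ∀ (σ : Fin 2) (p₀ : GridPoint L (2 * (2 * M))) (x : TorusSite 2 L),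
      (x ≠ p₀.2 ∧ (fun j => ((x - p₀.2) j).valMinAbs : Site 2) ∉ c.disk) → ∀ j₁ : Fin (2 * (2 * M)),
        ‖((hubbardGridSub L M β (2 * (2 * M))).transpose * hubbardCovAboveCT L M β μ 0 0 klE0 * hubbardGridSub L M β (2 * (2 * M)))
            (((p₀, σ), 0) : GridLeg (GridPoint L (2 * (2 * M)))) ((((j₁, x) : GridPoint L (2 * (2 * M))), σ), 1)‖ ≤ Sf)
    {bS : ℕ → ℝ}
    (hbS : ∀ k : Fin 3, (c.row k : ℝ) +
      Sf *
        (2 ^ (k : ℕ) * 2500 *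
          ((max 1 ((2 * (k : ℕ) : ℝ) / Real.arsinh (ω₁ / 4))) ^ (k : ℕ) * Real.exp (-(Real.arsinh (ω₁ / 4) * (c.Rc + 1))) *
            (1 + 2 * (1 - Real.exp (-(Real.arsinh (ω₁ / 4) / 4)))⁻¹) ^ 2) / ω₁ +
          (ω₀ * (Real.sqrt (![G₀lo, Real.sqrt (G₀lo * G₂lo), G₂lo] k) + (10 : ℝ)⁻¹ ^ 10) ^ 2 +
            ω₁ * (Real.sqrt (![G₀mid, Real.sqrt (G₀mid * G₂mid), G₂mid] k) + (10 : ℝ)⁻¹ ^ 10) ^ 2)) ≤ bS k) :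
    (∀ (σ : Fin 2) (p₀ : GridPoint L (2 * (2 * M))), ∑ p₁ : GridPoint L (2 * (2 * M)),
      (if p₁ = p₀ then (0 : ℝ) else (if p₁.2 - p₀.2 = 0 then (0 : ℝ) else 1) * ‖contr ℂ ((hubbardGridSub L M β (2 * (2 * M))).transpose * hubbardCovAboveCT L M β μ 0 0 klE0 *
                hubbardGridSub L M β (2 * (2 * M))) (((p₁, σ), 0) : GridLeg (GridPoint L (2 * (2 * M)))) ((p₀, σ), 1) *
              (contr ℂ ((hubbardGridSub L M β (2 * (2 * M))).transpose * hubbardCovAboveCT L M β μ 0 0 klE0 *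
                hubbardGridSub L M β (2 * (2 * M))) (((p₀, σ.rev), 0) : GridLeg (GridPoint L (2 * (2 * M)))) ((p₁, σ.rev), 1) *
                contr ℂ ((hubbardGridSub L M β (2 * (2 * M))).transpose * hubbardCovAboveCT L M β μ 0 0 klE0 *
                hubbardGridSub L M β (2 * (2 * M))) (((p₁, σ.rev), 0) : GridLeg (GridPoint L (2 * (2 * M)))) ((p₀, σ.rev), 1))‖) ≤ bS 0 * (((2 * (2 * M) : ℕ) : ℝ) / β)) ∧
    (∀ k, 1 ≤ k → k ≤ 2 → ∀ (σ : Fin 2) (p₀ : GridPoint L (2 * (2 * M))), ∑ p₁ : GridPoint L (2 * (2 * M)),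
      (if p₁ = p₀ then (0 : ℝ) else
        Real.sqrt ((((p₁.2 - p₀.2) 0).valMinAbs.natAbs : ℝ) ^ 2 + (((p₁.2 - p₀.2) 1).valMinAbs.natAbs : ℝ) ^ 2) ^ k * ‖contr ℂ ((hubbardGridSub L M β (2 * (2 * M))).transpose * hubbardCovAboveCT L M β μ 0 0 klE0 *
                hubbardGridSub L M β (2 * (2 * M))) (((p₁, σ), 0) : GridLeg (GridPoint L (2 * (2 * M)))) ((p₀, σ), 1) *
              (contr ℂ ((hubbardGridSub L M β (2 * (2 * M))).transpose * hubbardCovAboveCT L M β μ 0 0 klE0 *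
                hubbardGridSub L M β (2 * (2 * M))) (((p₀, σ.rev), 0) : GridLeg (GridPoint L (2 * (2 * M)))) ((p₁, σ.rev), 1) *
                contr ℂ ((hubbardGridSub L M β (2 * (2 * M))).transpose * hubbardCovAboveCT L M β μ 0 0 klE0 *
                hubbardGridSub L M β (2 * (2 * M))) (((p₁, σ.rev), 0) : GridLeg (GridPoint L (2 * (2 * M)))) ((p₀, σ.rev), 1))‖) ≤
        bS k * (((2 * (2 * M) : ℕ) : ℝ) / β)) := by
  have hβ₀ : (0 : ℝ) < klBetaMin := by norm_num [klBetaMin]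
  have hβpos : 0 < β := lt_of_lt_of_le hβ₀ hβ
  -- `hρ` from `2¹⁰ ≤ L`
  have h210 : 2 ^ 10 ≤ L := by
    refine le_trans ?_ hL3
    unfold klEngL₃
    have h1 : 1 ≤ (⌈|β|⌉₊ + 1) ^ 2 := Nat.one_le_pow _ _ (Nat.succ_pos _)
    have h2 : 1 ≤ (⌈|U|⁻¹⌉₊ + 1) ^ 2 := Nat.one_le_pow _ _ (Nat.succ_pos _)
    calc 2 ^ 10 = 2 ^ 10 * 1 * 1 := by norm_num
      _ ≤ 2 ^ 10 * (⌈|β|⌉₊ + 1) ^ 2 * (⌈|U|⁻¹⌉₊ + 1) ^ 2 := Nat.mul_le_mul (Nat.mul_le_mul_left _ h1) h2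
  have hρ := exp_neg_arsinh_mul_le_half_of_le (L := L) hω₁ h210
  -- the far lattice sums of the two low shells from their gaps
  set Dl : Fin 3 → ℝ := ![G₀lo, Real.sqrt (G₀lo * G₂lo), G₂lo] with hDldef
  set Dm : Fin 3 → ℝ := ![G₀mid, Real.sqrt (G₀mid * G₂mid), G₂mid] with hDmdef
  have hDl : ∀ (k : Fin 3) (i : MatsubaraIdx M), |matsubaraFreq β M i| < ω₀ →
      ∑' z : Site 2, (if z ≠ 0 ∧ z ∉ c.disk then Real.sqrt ((((z 0 : ℤ) : ℝ)) ^ 2 + (((z 1 : ℤ) : ℝ)) ^ 2) ^ (k : ℕ) else 0) *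
        ‖mFourierCoeff (Torus.descend (fun y : Momentum => uvSymbolFn 1 klE0 (frameLevel μ 0 ((2 * π) • y)) (matsubaraFreq β M i))
          (uvSpatialSymbol_isLatticePeriodic 1 klE0 μ 0 (matsubaraFreq β M i))) (-z)‖ ^ 2 ≤ Dl k := by
    intro k i hi
    have hne : matsubaraFreq β M i ≠ 0 := matsubaraFreq_ne_zero' hβpos i
    fin_cases k
    · exact farLattice_bare_zero_le_of_gap μ c.toSunsetCellRecordV2 hne (hgap0lo i hi)
    · exact farLattice_bare_one_le_of_gaps μ c.toSunsetCellRecordV2 hne (hgap0lo i hi) (hgap2lo i hi)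
    · exact farLattice_bare_two_le_of_gap μ c.toSunsetCellRecordV2 hne (hgap2lo i hi)
  have hDm : ∀ (k : Fin 3) (i : MatsubaraIdx M), (ω₀ ≤ |matsubaraFreq β M i| ∧ |matsubaraFreq β M i| < ω₁) →
      ∑' z : Site 2, (if z ≠ 0 ∧ z ∉ c.disk then Real.sqrt ((((z 0 : ℤ) : ℝ)) ^ 2 + (((z 1 : ℤ) : ℝ)) ^ 2) ^ (k : ℕ) else 0) *
        ‖mFourierCoeff (Torus.descend (fun y : Momentum => uvSymbolFn 1 klE0 (frameLevel μ 0 ((2 * π) • y)) (matsubaraFreq β M i))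
          (uvSpatialSymbol_isLatticePeriodic 1 klE0 μ 0 (matsubaraFreq β M i))) (-z)‖ ^ 2 ≤ Dm k := by
    intro k i hi
    have hne : matsubaraFreq β M i ≠ 0 := matsubaraFreq_ne_zero' hβpos i
    fin_cases k
    · exact farLattice_bare_zero_le_of_gap μ c.toSunsetCellRecordV2 hne (hgap0mid i hi.1 hi.2)
    · exact farLattice_bare_one_le_of_gaps μ c.toSunsetCellRecordV2 hne (hgap0mid i hi.1 hi.2) (hgap2mid i hi.1 hi.2)
    · exact farLattice_bare_two_le_of_gap μ c.toSunsetCellRecordV2 hne (hgap2mid i hi.1 hi.2)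
  -- the two envelopes under the engine thresholds
  have hlo := l2Far_envelope_of_farLattice_klEng_on (L := L) μ hβ hU0 hU hL3 (fun i : MatsubaraIdx M => |matsubaraFreq β M i| < ω₀)
    c.toSunsetCellRecordV2 hDl
  have hmid' := l2Far_envelope_of_farLattice_klEng_on (L := L) μ hβ hU0 hU hL3
    (fun i : MatsubaraIdx M => ω₀ ≤ |matsubaraFreq β M i| ∧ |matsubaraFreq β M i| < ω₁) c.toSunsetCellRecordV2 hDm
  exact sunsetRows_of_certV3_threeShells_farSup (L := L) c hc hμlo hμhi hβ hδ hN' hR hT hrow hω₀ hω₁ hρ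
    (Dlo := fun k => (Real.sqrt (Dl k) + (10 : ℝ)⁻¹ ^ 10) ^ 2) (Dmid := fun k => (Real.sqrt (Dm k) + (10 : ℝ)⁻¹ ^ 10) ^ 2)
    (fun k => sq_nonneg _) (fun k => sq_nonneg _) hlo (fun k i h1 h2 => hmid' k i ⟨h1, h2⟩) hSf0 hA2 hbS

end Summit.HubbardSuperconductivity.HubbardSuperconductivity.Theorems.KLRegimeSplit

end
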